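import Literature.Topology.FourManifolds.SmoothOrientation
import Literature.Topology.FourManifolds.HomotopyS4OrientableProofs
import Literature.Topology.FourManifolds.SmoothOrientationProofs
import Literature.Topology.FourManifolds.SmoothOrientationConnectedProofs
import Literature.Topology.FourManifolds.OrientedConnectedSumTransportProofs
import Literature.Topology.FourManifolds.SliceDiscInTransport
import HarnessLib

/-!
# Stub `stub_chartOrientation` of line `embed-dont-dissolve` for crux `ZeroSurgeryExotic.ZseSVanishesOnPairs`
(item stmt-SmoothPoincare4-0368, route route-SmoothPoincare4-ZeroSurgeryExotic)

**Orienting the ball chart of a homotopy 4-sphere.**  A closed smooth 4-manifold `X` homotopy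
equivalent to `S⁴` carries, for every smooth ball `e : ℝ⁴ ↪ X` (a `C^∞` embedding of the model
space), a smooth orientation `oX` for which `e` is ORIENTATION PRESERVING from the standard
orientation `SmoothOrientation.euclidean 4` of `ℝ⁴`.

Proof (Hirsch, *Differential Topology* (1976), §4.4; Lee, *Introduction to Smooth Manifolds*
(2013), Thm. 15.43), entirely over proved tree theorems:

* `X` is orientable — `Literature.Topology.FourManifolds.isOrientable_of_homotopyEquiv_sphere_four_holds`
  (`S⁴` is simply connected, simple connectivity is a homotopy invariant, simply connected
  manifolds are orientable by the orientation covering); pick any orientation `o`.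
* The ball `e` has open range (invariance of domain for equidimensional smooth embeddings,
  `Literature.Topology.FourManifolds.isOpen_range_of_isSmoothEmbedding_disc`), so it is a
  diffeomorphism of the connected `ℝ⁴` onto an open submanifold of `X` and therefore either
  preserves or reverses the orientations `(euclidean, o)`
  (`Literature.Topology.FourManifolds.isOrientationPreserving_or_isOrientationReversing_disc`,
  Hirsch §4.4, p. 101).  In the first case `oX = o`, in the second `oX = -o`
  (`IsOrientationReversing oM oN f` is by definition `IsOrientationPreserving oM (-oN) f`).

Compactness, Hausdorffness and second countability of `X` are only carried because the registered
signature quantifies over closed manifolds; the argument uses none of them beyond orientability.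
-/

noncomputable section

-- the prescribed namespace `Summit.<P>.<Sub>.…` duplicates `SmoothPoincare4` (P = Sub)
set_option linter.dupNamespace false

open scoped Manifold ContDiff Topology
open Set Function ContinuousMap
open Literature.Topology.FourManifolds

namespace Summit.SmoothPoincare4.SmoothPoincare4.Theorems.ZseSVanishesOnPairs

/-- Local notation: the model space `ℝⁿ`. -/
local notation "𝔼 " n:arg => EuclideanSpace ℝ (Fin n)
/-- Local notation: the round 4-sphere. -/
local notation "𝕊⁴" => (Metric.sphere (0 : EuclideanSpace ℝ (Fin 5)) 1)

/-- **Orienting the ball chart (stub `stub_chartOrientation` of line `embed-dont-dissolve`).**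
A closed smooth homotopy 4-sphere `X` carries a smooth orientation `oX` for which a given smooth
ball `e : ℝ⁴ ↪ X` is orientation preserving from the standard orientation of `ℝ⁴`: `X` is
orientable (`isOrientable_of_homotopyEquiv_sphere_four_holds`, Lee Thm. 15.43), and an open
smooth embedding of the connected `ℝ⁴` either preserves or reverses any pair of orientations
(`isOrientationPreserving_or_isOrientationReversing_disc`; its range is open by
`isOpen_range_of_isSmoothEmbedding_disc`), so `o` or `-o` works for any orientation `o` of `X`
(Hirsch, *Differential Topology*, GTM 33 (1976), Ch. 4 §4, p. 101: a diffeomorphism of connected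
oriented manifolds preserves or reverses orientation). [cite: HirschDT1976, §4.4] -/
theorem stub_chartOrientation :
    ∀ (X : Type) [TopologicalSpace X] [T2Space X] [SecondCountableTopology X] [ChartedSpace (𝔼 4) X]
      [IsManifold (𝓡 4) ∞ X] [CompactSpace X] (e : 𝔼 4 → X),
      Nonempty (X ≃ₕ 𝕊⁴) → Manifold.IsSmoothEmbedding (𝓡 4) (𝓡 4) ∞ e →
      ∃ oX : SmoothOrientation (𝓡 4) X, IsOrientationPreserving (SmoothOrientation.euclidean 4) oX e := by
  intro X _ _ _ _ _ _ e hX he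
  obtain ⟨h⟩ := hX
  obtain ⟨o⟩ := isOrientable_of_homotopyEquiv_sphere_four_holds X h
  have ho : IsOpen (range e) := isOpen_range_of_isSmoothEmbedding_disc he
  rcases isOrientationPreserving_or_isOrientationReversing_disc he ho (euclideanOrientation 4) o
    with h₁ | h₁
  · exact ⟨o, h₁⟩
  · exact ⟨-o, h₁⟩

end Summit.SmoothPoincare4.SmoothPoincare4.Theorems.ZseSVanishesOnPairs

end
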